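import Mathlib
import Summits.Ventures.PercRepro2.UniversalSeriesStep2

/-! # The chain-shift relay of a bundle, and the (UH*) assignment of a bundle on `Finset (Fin K)`
(seat mine-b, cell pub-perc-repro2; MINE-B.md §25.2)

The bundle `B_K` of `K` parallel free edges has the configuration cube `Finset (Fin K)` (the blue
edges), red label `K − |z|` and blue label `|z|`.  Its **relay** (MINE-B.md §25.1: an injection of
the nonempty sets into the proper subsets, `σ z ⊆ z`, `|σ z| ≥ |z| − 1`) is the **chain shift**
`chainShift`: a suffix `[j, K)` loses its minimum `j`, every other set is fixed.  Its (UH*)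
assignment is `bkAssign`: the only source is `univ` (red `0`, blue `K`), and its slot `i` owns
`univ.erase i`.  Both are stated in the form the series-step theorem
`universal_ser_of_maps_pi` takes (`chainShift_inj`, `chainShift_spec`, `universal_bundleFin`), with
the decoding facts the bundle instance of the series step needs: `chainShift z = ∅` only for
`z = {K−1}`, `chainShift univ = univ.erase 0`, and a set that is not a suffix is its own only
preimage (`chainShift_eq_of_not_suf`). -/

namespace Summit.Ventures.PercRepro2.UHClosure

open Finset

section bundle

variable {K : ℕ}

/-- the red label of the bundle: the number of red edges -/
def rB (z : Finset (Fin K)) : ℕ := K - z.card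
/-- the blue label of the bundle: the number of blue edges -/
def bB (z : Finset (Fin K)) : ℕ := z.card

/-- a suffix of `Fin K`: closed upwards -/
def IsSuf (z : Finset (Fin K)) : Prop := ∀ c ∈ z, ∀ c' : Fin K, c ≤ c' → c' ∈ z

/-- being a suffix is decidable -/
instance (z : Finset (Fin K)) : Decidable (IsSuf z) := by unfold IsSuf; infer_instance

/-- the chain shift: a nonempty suffix loses its minimum, every other set is fixed -/
def chainShift (z : Finset (Fin K)) : Finset (Fin K) :=
  if h : z.Nonempty ∧ IsSuf z then z.erase (z.min' h.1) else z

/-- a nonempty suffix is the upper interval of its minimum -/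
lemma suf_eq_Ici {z : Finset (Fin K)} (hz : z.Nonempty) (hs : IsSuf z) : z = Ici (z.min' hz) := by
  ext c
  simp only [mem_Ici]
  constructor
  · intro hc; exact min'_le z c hc
  · intro hc; exact hs _ (min'_mem z hz) c hc

/-- the chain shift of a nonempty suffix is the open upper interval of its minimum -/
lemma chainShift_of_suf {z : Finset (Fin K)} (hz : z.Nonempty) (hs : IsSuf z) :
    chainShift z = Ioi (z.min' hz) := by
  unfold chainShift
  rw [dif_pos ⟨hz, hs⟩]
  ext c
  simp only [mem_erase, mem_Ioi]
  constructor
  · rintro ⟨hne, hc⟩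
    exact lt_of_le_of_ne (min'_le z c hc) (Ne.symm hne)
  · intro hc
    exact ⟨ne_of_gt hc, hs _ (min'_mem z hz) c (le_of_lt hc)⟩

/-- the chain shift fixes every set that is not a nonempty suffix -/
lemma chainShift_of_not_suf {z : Finset (Fin K)} (h : ¬ (z.Nonempty ∧ IsSuf z)) : chainShift z = z := by
  unfold chainShift; rw [dif_neg h]

/-- an open upper interval is a suffix -/
lemma isSuf_Ioi (m : Fin K) : IsSuf (Ioi m) := by
  intro c hc c' hcc'
  simp only [mem_Ioi] at hc ⊢
  exact lt_of_lt_of_le hc hcc'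

/-- `univ` is a suffix -/
lemma isSuf_univ : IsSuf (univ : Finset (Fin K)) := fun _ _ _ _ => mem_univ _

/-- open upper intervals of a linear order are determined by their endpoint -/
lemma Ioi_inj_fin {m m' : Fin K} (h : Ioi m = Ioi m') : m = m' := by
  by_contra hne
  rcases lt_or_gt_of_ne hne with hlt | hlt
  · have : m' ∈ Ioi m := by simpa using hlt
    rw [h] at this; simp at this
  · have : m ∈ Ioi m' := by simpa using hlt
    rw [← h] at this; simp at this

/-- the chain shift of a set lies below it -/
lemma chainShift_subset (z : Finset (Fin K)) : chainShift z ⊆ z := by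
  unfold chainShift
  split_ifs
  · exact erase_subset _ _
  · exact subset_refl _

/-- the chain shift drops at most one element -/
lemma card_le_card_chainShift_add_one (z : Finset (Fin K)) : z.card ≤ (chainShift z).card + 1 := by
  unfold chainShift
  split_ifs with h
  · rw [card_erase_add_one (min'_mem z h.1)]
  · omega

/-- the chain shift of a nonempty set is never `univ` -/
lemma chainShift_ne_univ {z : Finset (Fin K)} (hz : z.Nonempty) : chainShift z ≠ univ := by
  unfold chainShift
  split_ifs with h
  · intro he
    have : z.min' h.1 ∈ z.erase (z.min' h.1) := by rw [he]; exact mem_univ _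
    simp at this
  · intro he
    exact h ⟨hz, he ▸ isSuf_univ⟩

/-- the chain shift is injective on the nonempty sets -/
lemma chainShift_inj {z z' : Finset (Fin K)} (hz : z.Nonempty) (hz' : z'.Nonempty)
    (h : chainShift z = chainShift z') : z = z' := by
  by_cases hs : IsSuf z <;> by_cases hs' : IsSuf z'
  · rw [chainShift_of_suf hz hs, chainShift_of_suf hz' hs'] at h
    rw [suf_eq_Ici hz hs, suf_eq_Ici hz' hs', Ioi_inj_fin h]
  · exfalso
    rw [chainShift_of_suf hz hs, chainShift_of_not_suf (fun h' => hs' h'.2)] at h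
    exact hs' (h ▸ isSuf_Ioi _)
  · exfalso
    rw [chainShift_of_not_suf (fun h' => hs h'.2), chainShift_of_suf hz' hs'] at h
    exact hs (h.symm ▸ isSuf_Ioi _)
  · rwa [chainShift_of_not_suf (fun h' => hs h'.2), chainShift_of_not_suf (fun h' => hs' h'.2)] at h

/-- a set that is not a suffix is its own only preimage under the chain shift -/
lemma chainShift_eq_of_not_suf {z w : Finset (Fin K)} (hz : z.Nonempty) (hw : ¬ IsSuf w)
    (h : chainShift z = w) : z = w := by
  by_cases hs : IsSuf z
  · exfalso
    rw [chainShift_of_suf hz hs] at h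
    exact hw (h ▸ isSuf_Ioi _)
  · rwa [chainShift_of_not_suf (fun h' => hs h'.2)] at h

/-- the chain shift of `univ` is `univ` minus `0` -/
lemma chainShift_univ (hK : 0 < K) : chainShift (univ : Finset (Fin K)) = univ.erase ⟨0, hK⟩ := by
  have hne : (univ : Finset (Fin K)).Nonempty := ⟨⟨0, hK⟩, mem_univ _⟩
  unfold chainShift
  rw [dif_pos ⟨hne, isSuf_univ⟩]
  congr 1
  apply le_antisymm (min'_le _ _ (mem_univ _))
  apply le_min'
  intro c _
  exact Fin.le_iff_val_le_val.2 (Nat.zero_le _)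

/-- the chain shift vanishes only on the singleton of the last element -/
lemma eq_last_of_chainShift_eq_empty {z : Finset (Fin K)} (hz : z.Nonempty) (h : chainShift z = ∅) :
    z = {z.min' hz} ∧ ∀ c : Fin K, c ≤ z.min' hz := by
  by_cases hs : IsSuf z
  · rw [chainShift_of_suf hz hs] at h
    have hmax : ∀ c : Fin K, c ≤ z.min' hz := by
      intro c
      by_contra hc
      have : c ∈ Ioi (z.min' hz) := by simpa using lt_of_not_ge hc
      rw [h] at this; simp at this
    refine ⟨?_, hmax⟩
    ext c
    simp only [mem_singleton]
    constructor
    · intro hc; exact le_antisymm (hmax c) (min'_le z c hc)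
    · intro hc; rw [hc]; exact min'_mem z hz
  · exfalso
    rw [chainShift_of_not_suf (fun h' => hs h'.2)] at h
    exact hz.ne_empty h

/-- the relay hypotheses of the series-step theorem, for the bundle -/
theorem chainShift_relay_inj (z z' : Finset (Fin K)) (hz : 1 ≤ bB z) (hz' : 1 ≤ bB z')
    (h : chainShift z = chainShift z') : z = z' :=
  chainShift_inj (card_pos.1 hz) (card_pos.1 hz') h

/-- the relay hypotheses of the series-step theorem, for the bundle -/
theorem chainShift_relay_spec (z : Finset (Fin K)) (hz : 1 ≤ bB z) :
    chainShift z ≤ z ∧ 1 ≤ rB (chainShift z) ∧ bB z ≤ bB (chainShift z) + 1 := by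
  refine ⟨chainShift_subset z, ?_, card_le_card_chainShift_add_one z⟩
  unfold rB
  have h1 : (chainShift z).card ≤ K := by
    have := card_le_univ (chainShift z); simpa using this
  have h2 : (chainShift z).card ≠ K := by
    intro he
    apply chainShift_ne_univ (card_pos.1 hz)
    exact eq_univ_of_card _ (by simpa using he)
  omega

/-! ### The (UH*) assignment of the bundle -/

/-- a source of the bundle is `univ` -/
lemma bundle_src_eq_univ {z : Finset (Fin K)} (h : USrc (rB (K := K)) bB z) : z = univ := by
  apply eq_univ_of_card
  have h1 := h.1; unfold rB at h1
  have := card_le_univ z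
  simp only [Fintype.card_fin] at this ⊢
  omega

/-- the index of a bundle slot, as an element of `Fin K` -/
def bkIdx (q : SlotL (USrc (rB (K := K)) bB) bB) : Fin K :=
  ⟨q.1.2.val, by
    have h1 := q.2
    have h2 := bundle_src_eq_univ q.1.1.2.1
    unfold bB at h1; rw [h2] at h1; simpa using h1⟩

/-- the (UH*) assignment of the bundle: slot `i` of `univ` owns `univ.erase i` -/
def bkAssign (q : SlotL (USrc (rB (K := K)) bB) bB) : Finset (Fin K) := univ.erase (bkIdx q)

/-- the bundle assignment is injective -/
theorem bkAssign_injective : Function.Injective (bkAssign (K := K)) := by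
  intro q q' h
  unfold bkAssign at h
  have h1 : bkIdx q = bkIdx q' := erase_injOn univ (mem_univ _) (mem_univ _) h
  have h2 : q.1.2.val = q'.1.2.val := congrArg (fun i : Fin K => i.val) h1
  apply Subtype.ext; apply Prod.ext
  · exact Subtype.ext ((bundle_src_eq_univ q.1.1.2.1).trans (bundle_src_eq_univ q'.1.1.2.1).symm)
  · exact Fin.ext h2

/-- the bundle assignment has the (UH*) target properties -/
theorem bkAssign_spec (q : SlotL (USrc (rB (K := K)) bB) bB) :
    bkAssign q ≤ q.1.1.1 ∧ rB (bkAssign q) = 1 ∧ bB q.1.1.1 ≤ bB (bkAssign q) + 1 := by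
  have hu := bundle_src_eq_univ q.1.1.2.1
  have hc : (bkAssign q).card + 1 = K := by
    unfold bkAssign
    rw [card_erase_add_one (mem_univ _)]; simp
  refine ⟨?_, ?_, ?_⟩
  · rw [hu]; exact subset_univ _
  · unfold rB; omega
  · unfold bB; rw [hu]; simp only [card_univ, Fintype.card_fin]; unfold bkAssign at hc ⊢; omega

/-- **(UH*) on the bundle `B_K`, on the cube `Finset (Fin K)`.** -/
theorem universal_bundleFin : Universal (rB (K := K)) bB :=
  ⟨bkAssign, bkAssign_injective, bkAssign_spec⟩

end bundle

end Summit.Ventures.PercRepro2.UHClosure
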